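import Literature.IUT.HodgeTheaters.TemperedCoveringsCor23viOfSpecialFibre
import Literature.AnabelianGeometry.SemiGraphs.TemperedCompactInVerticialFinite
import Literature.AnabelianGeometry.SemiGraphs.TemperedVerticialDistinctSameVertex
import Literature.AnabelianGeometry.SemiGraphs.TemperedDecompositionOfProfinite
import HarnessLib

/-!
# [IUTchI] Cor. 2.3 (vi) at the GENUINE 𝔛-datum: the base cusp incidence is a THEOREM at an intrinsic vertex;
# with the cusp predicate in GROUP form the node has ONE residual law and is law-free at `ℍ ⊇ V(𝔾)`

S. Mochizuki, *Inter-universal Teichmüller theory I: construction of Hodge theaters*, kurims manuscript (May 2020),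
§2, Corollary 2.3 (vi) p. 48 ("`I_x` lies in a `Δ^tp_X`-conjugate of `Δ^tp_{X,ℍ}` (resp. `Δ̂_X`-conjugate of
`Δ̂_{X,ℍ}`) if and only if `ξ` meets an irreducible component of the special fiber contained in `ℍ`"), proof p. 49
l. 62–64 ("follows immediately from a similar argument to the argument applied in the proof of [CombGC], Proposition
1.5, (i), by passing to pro-`Σ` completions") [cite: Mochizuki2012, Cor 2.3(vi) pp.48-49] (D-0012 claim key; series
status DISPUTED; nothing of the series is asserted — PROVED below are statements about the tree's own objects);
S. Mochizuki, *Semi-graphs of anabelioids*, Publ. RIMS **42** (2006), Thm. 3.7 (i)–(iv) pp. 40–41, Ex. 3.10 p. 44,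
§6 p. 71 (`I_x ≅ Ẑ(1)`) [cite: MochizukiSemiAnbd2006, Thm 3.7 pp.40-41].

PROOF-ONLY file (abc-iut cell, seat abc-iut-L5-d5 gen 8; cone row `IUTchI:Cor2.3(vi)`, split (B) of L5-lead RULINGS #111
(1); no definition, no instance, no new `Prop` fact).  Consumed BY NAME, never restated: `map_ρTp_inertiaTp_ofSpecialFibre`,
`exists_verticial_le_of_mem_decompSubgroups` (abc-iut-w4-d070), `cor23vi_of_graph`/`cor23vi_iff_graph` (abc-iut-L5-d5), the
datum `ofSpecialFibre` (abc-iut-L5-t11), abc-iut-L3's `CompactInVerticialAt`/`compactInVerticialAt_of_finiteGraph'` (Thm. 3.7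
(iii) at FINITE `𝔾`), `verticialDistinct_holds` (Thm. 3.7 (ii)), `edgeLikeDistinctAt_of_finiteGraph`,
`exists_conj_of_mem_verticialSubgroups` (Thm. 3.7 (i)), `TemperedCurve.compactSpace_inertia_of_isCusp` (§6 p. 71).

QUESTION OF RECORD (RULINGS #111 (1)): does the BASE CUSP INCIDENCE `hcusp` (GAP G-w4d070-g11-1: `J_x := S.admissible(I_x ∩ Δ)`
lies in a verticial subgroup of `π₁^temp(G^c)` at the RECORD's vertex `(P.proj i)(P.vtxOfCusp i x)`) follow from abc-iut-L3's
origin record `SpecialFibreTower.PiData` ((P3) `inertia_le_verticial`, stated at the tower levels)?  ANSWER (this file):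
* AT THE RECORD'S VERTEX — NO (structural): `PiData X d S T` couples the levels `T.chart i`, `T.adm i` to the base
  `S.chart`, `S.admissible` ONLY through the semi-graph projections `proj i` and through `Δ`; it carries no group
  homomorphism `π₁^temp(𝒢^c_i) → π₁^temp(𝒢^c)` over `S.admissible` (not even `T.LiesOver S`), a fortiori none carrying
  verticial subgroups at `w` to verticial subgroups at `proj i w`; and through any such homomorphism (P3) would bound only
  the image of `I_x ∩ N_i`, a finite-index subgroup of `J_x`.  So G-w4d070-g11-1 stays ORIGIN DATA (L3 DEFS lane).
* AT AN INTRINSIC VERTEX — YES, a THEOREM (`exists_verticial_ge_cuspImage`): `J_x` is COMPACT (`I_x ≅ Ẑ(1)`,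
  `isCompact_cuspImage`) hence lies in a verticial subgroup at SOME vertex of `𝔾^c` ([SemiAnbd] Thm. 3.7 (iii) at the
  FINITE special fibre, `P.finite`); so `hcusp` holds for an intrinsic cusp ↦ vertex assignment (`exists_vtx_cuspVerticial`).
CONSEQUENCE FOR THE NODE.  Reading print's (vi)(b) atom "`ξ_x` meets an irreducible component contained in `ℍ`" in GROUP
form — `∃ v ∈ ℍ, J_x` lies in a verticial subgroup at `v` (it coincides with the record's vertex predicate under the
cusp ↦ open-edge dictionary, `verticialOver_iff_vtx_mem_of_openEdgeLike`) — the TEMPERED clause (b ⇒ a) is LAW-FREE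
(`inertia_le_conj_of_verticialOver`), the node AS TYPED at the genuine datum is EQUIVALENT to ONE profinite incidence law
`hhatV` (`cor23vi_ofSpecialFibre_verticialOver_iff_hatIncidence`) whose statement mentions NO origin data (so it is
closable in-cone by the [CombGC] Prop. 1.5 (i)-type pro-`Σ̂` argument — row «COR23VI-HATH-PROSIGMA», not attempted here),
and at every `ℍ` containing all vertices of `𝔾^c` the node HOLDS OUTRIGHT (`cor23vi_ofSpecialFibre_verticialOver_of_verts_univ`,
ZERO laws).  RELATION TO abc-iut-w4-d070's binders: `{hcusp, hhatH} ⇒ hhatV` (`hatIncidence_verticialOver_of_cuspLaws`);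
conversely `hhatV ∧ hcusp ⇒ hhatH` once the record's vertex is the UNIQUE carrier of `J_x`, which HOLDS when `J_x ≠ 1` is
edge-like for an OPEN edge (`eq_of_verticial_ge_of_openEdgeLike`: Thm. 3.7 (ii)+(iii)+`EdgeLikeDistinct`) — i.e. exactly
under the finer dictionary that G-w4d070-g11-1 names.

BINDER CENSUS (DATA · DATUM-INTERNAL · FACT-INSTANCE · LAW): `X d S Σ Σ̂ hsub hne hprime hp H TpH` DATA; `h36`, `hTpHv`/`hTpH
hconn hv`, `hV hE : Finite` (= `P.finite`) DATUM-INTERNAL; `hCV : CompactInVerticialAt S.Gc` THEOREM-class (discharged by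
`compactInVerticialAt_of_finiteGraph'` at the finite fibre; a binder only in the general-`𝔾` forms); `hhatV` LAW (profinite
incidence, group form) — the ONLY law of the main closer; `hcusp`, `hedge`, `hJ1` occur only in the comparison lemmas of §5.
FACT-INSTANCE 0.  Model-RELATIVE (the genuine datum `ofSpecialFibre`); typed ≠ discharged for the [IUTchI] claim keys;
nothing here bears on [IUTchIII] Cor. 3.12 or asserts that abc is proved or refuted.
-/

noncomputable section

namespace Literature.IUT.HodgeTheaters
open _root_.Topology
open scoped Pointwise
open Literature.AnabelianGeometry.SemiGraphs
open Literature.AnabelianGeometry.SemiGraphs.ProfiniteSemiGraph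

universe u
namespace StableCurveTemperedData

/-! ### 0. Group-theoretic bookkeeping -/

/-- `K.map (conj t) = t • K` (pointwise). [folklore] -/
private theorem map_conj_eq_smul {G : Type*} [Group G] (K : Subgroup G) (t : G) :
    K.map (MulAut.conj t).toMonoidHom = MulAut.conj t • K := by
  ext y
  constructor
  · rintro ⟨s, hs, rfl⟩
    exact Subgroup.smul_mem_pointwise_smul _ _ _ hs
  · intro hy
    obtain ⟨s, hs, rfl⟩ := (Subgroup.mem_smul_pointwise_iff_exists y _ _).mp hy
    exact ⟨s, hs, rfl⟩

/-- The image under a continuous homomorphism `Δ → H` of `I ∩ Δ`, for a COMPACT subgroup `I ≤ Δ`, is compact. [folklore] -/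
private theorem isCompact_coe_map_subgroupOf {G H : Type*} [Group G] [TopologicalSpace G] [Group H]
    [TopologicalSpace H] {I Δ : Subgroup G} (hle : I ≤ Δ) (hI : CompactSpace I) (f : Δ →ₜ* H) :
    IsCompact (((I.subgroupOf Δ).map f.toMonoidHom : Subgroup H) : Set H) := by
  haveI := hI
  have hc : Continuous fun i : I => f (Subgroup.inclusion hle i) :=
    f.continuous.comp (Continuous.subtype_mk continuous_subtype_val _)
  convert isCompact_range hc using 1
  ext y
  simp only [SetLike.mem_coe, Subgroup.mem_map, Subgroup.mem_subgroupOf, Set.mem_range,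
    ContinuousMonoidHom.coe_toMonoidHom]
  constructor
  · rintro ⟨z, hz, rfl⟩
    exact ⟨⟨z.1, hz⟩, rfl⟩
  · rintro ⟨i, rfl⟩
    exact ⟨Subgroup.inclusion hle i, i.2, rfl⟩

/-! ### 1. Chart level: "verticial over `ℍ`" ⇒ sub-conjugate to `Π^tp_ℍ`; uniqueness of the carrying vertex -/

/-- **Tempered clause, group form, at the chart** ([SemiAnbd] Thm. 3.7 (i) "one conjugacy class"): if `J` lies in a
verticial subgroup at a vertex `v ∈ ℍ` and `T` contains a verticial subgroup of every vertex of `ℍ`, then `J ⊆ t·T·t⁻¹`.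
[cite: MochizukiSemiAnbd2006, Thm 3.7(i) p.40] -/
theorem le_conj_smul_of_verticialOver {𝒢 : ProfiniteSemiGraph.{u}} (c : TemperedPiChart 𝒢)
    {H : 𝒢.graph.Subgraph} {T J : Subgroup c.G} (hTv : ∀ v ∈ H.verts, ∃ K ∈ verticialSubgroups c v, K ≤ T)
    (hJ : ∃ v ∈ H.verts, ∃ K ∈ verticialSubgroups c v, J ≤ K) : ∃ t : c.G, J ≤ MulAut.conj t • T := by
  obtain ⟨v, hv, K, hK, hJK⟩ := hJ
  obtain ⟨K₁, hK₁, hK₁T⟩ := hTv v hv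
  obtain ⟨t, ht⟩ := exists_conj_of_mem_verticialSubgroups c hK₁ hK
  exact ⟨t, (hJK.trans_eq ht).trans ((Subgroup.map_mono hK₁T).trans_eq (map_conj_eq_smul T t))⟩

/-- **A nontrivial compact OPEN-edge-like subgroup is verticial at ONE vertex only** ([SemiAnbd] Thm. 3.7 (ii) verticial
subgroups of distinct vertices are distinct; (iii) a nontrivial compact subgroup of two distinct verticial subgroups is
edge-like for a CLOSED edge; `EdgeLikeDistinct`: edge-like subgroups of distinct edges have infinite mutual index).
[cite: MochizukiSemiAnbd2006, Thm 3.7(ii)(iii) pp.40-41] -/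
theorem eq_of_verticial_ge_of_openEdgeLike {𝒢 : ProfiniteSemiGraph.{u}} (h37 : 𝒢.Thm37Hypotheses)
    (hCV : CompactInVerticialAt 𝒢) (hED : EdgeLikeDistinctAt 𝒢) (c : TemperedPiChart 𝒢) {J : Subgroup c.G}
    (hJc : IsCompact (J : Set c.G)) (hJ1 : J ≠ ⊥) {e : 𝒢.graph.Edge} (he : ¬ 𝒢.graph.IsClosedEdge e)
    (hJe : J ∈ edgeLikeSubgroups c e) {v v' : 𝒢.graph.Vertex} {K K' : Subgroup c.G}
    (hK : K ∈ verticialSubgroups c v) (hK' : K' ∈ verticialSubgroups c v') (hJK : J ≤ K) (hJK' : J ≤ K') :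
    v = v' := by
  by_contra hne
  have hKK' : K ≠ K' := by
    intro h
    have h0 := (verticialDistinct_holds 𝒢 h37 c).1 v v' K K' hK hK' hne
    rw [h, Subgroup.relIndex_self] at h0
    exact one_ne_zero h0
  obtain ⟨e', L', he', hL', hJL'⟩ := ((hCV h37 c J hJc).2 hJ1 v v' K K' hK hK' hKK' hJK hJK').2
  have h0 := hED h37 c e e' J L' hJe hL' (fun h => he (h ▸ he'))
  rw [Subgroup.relIndex_eq_one.mpr hJL'] at h0
  exact one_ne_zero h0

section Rows

variable {p : ℕ} [Fact p.Prime] (X : TemperedCurve p) (d : X.GroupLevelData)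
  (S : SpecialFibreData (X.toTemperedArithmeticGroup d)) (h36 : S.Gc.Prop36Hypotheses)
  (Sigma SigmaHat : Set ℕ) (hsub : Sigma ⊆ SigmaHat) (hne : Sigma.Nonempty)
  (hprime : ∀ q ∈ SigmaHat, q.Prime) (hp : p ∉ Sigma)
  (TpH : Subgroup S.chart.G)

/-! ### 2. The base cusp incidence at SOME vertex is a THEOREM -/

/-- **`J_x = S.admissible(I_x ∩ Δ)` is compact** (`I_x ≅ Ẑ(1)` at a cusp, [SemiAnbd] §6 p. 71; continuous image).
[cite: MochizukiSemiAnbd2006, §6 p.71] -/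
theorem isCompact_cuspImage (x : {x : X.Pt // X.IsCusp x}) :
    IsCompact ((((X.inertia x.1).subgroupOf (X.toTemperedArithmeticGroup d).delta).map
      S.admissible.toMonoidHom : Subgroup S.chart.G) : Set S.chart.G) := by
  have hle : X.inertia x.1 ≤ (X.toTemperedArithmeticGroup d).delta := by
    rw [TemperedCurve.toTemperedArithmeticGroup_delta]
    exact inf_le_right
  exact isCompact_coe_map_subgroupOf hle (X.compactSpace_inertia_of_isCusp x.2) S.admissible

/-- **Base cusp incidence at SOME vertex** (THEOREM): `J_x` lies in a verticial subgroup of `π₁^temp(G^c)` at some vertex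
of `𝔾^c` — [SemiAnbd] Thm. 3.7 (iii) ("any compact subgroup is contained in a verticial subgroup") for the compact `J_x`,
under `CompactInVerticialAt S.Gc` (a THEOREM at the finite special fibre: `compactInVerticialAt_of_finiteGraph'`).
[cite: MochizukiSemiAnbd2006, Thm 3.7(iii) p.41] -/
theorem exists_verticial_ge_cuspImage (hCV : CompactInVerticialAt S.Gc) (x : {x : X.Pt // X.IsCusp x}) :
    ∃ (v : S.Gc.graph.Vertex), ∃ K ∈ verticialSubgroups S.chart v,
      ((X.inertia x.1).subgroupOf (X.toTemperedArithmeticGroup d).delta).map S.admissible.toMonoidHom ≤ K := by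
  obtain ⟨v, K, hK, hJK⟩ := (hCV S.hyp S.chart _ (isCompact_cuspImage X d S x)).1
  exact ⟨v, K, hK, hJK⟩

/-- **`hcusp` for an INTRINSIC cusp ↦ vertex assignment** (THEOREM): there is `vtx : cusps → V(𝔾^c)` with `J_x` verticial
at `vtx x` for every cusp — abc-iut-w4-d070's binder `hcusp` discharged for THIS `vtx` (not for the record's vertex, which is
origin data). [cite: MochizukiSemiAnbd2006, Thm 3.7(iii) p.41] -/
theorem exists_vtx_cuspVerticial (hCV : CompactInVerticialAt S.Gc) :
    ∃ vtx : {x : X.Pt // X.IsCusp x} → S.Gc.graph.Vertex, ∀ x, ∃ K ∈ verticialSubgroups S.chart (vtx x),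
      ((X.inertia x.1).subgroupOf (X.toTemperedArithmeticGroup d).delta).map S.admissible.toMonoidHom ≤ K :=
  ⟨fun x => (exists_verticial_ge_cuspImage X d S hCV x).choose,
    fun x => (exists_verticial_ge_cuspImage X d S hCV x).choose_spec⟩

/-! ### 3. The node with print's (vi)(b) atom in GROUP form: "`J_x` is verticial over `ℍ`" -/

/-- **Tempered clause (b ⇒ a), LAW-FREE**: if `J_x` is verticial at a vertex of `ℍ` and `Π^tp_ℍ = TpH` contains a verticial
subgroup of every vertex of `ℍ`, then `J_x = ρ^tp(I_x)` lies in a `Π^tp_𝔾`-conjugate of `Π^tp_ℍ` (any `Π̂_ℍ`, `hle`, atom).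
[cite: Mochizuki2012, Cor 2.3(vi) pp.48-49] [claim: Mochizuki2012, status: disputed] -/
theorem inertia_le_conj_of_verticialOver
    (HatH : Subgroup (TemperedGraphGroupData.exists_completion_of_prop36 S.Gc h36 S.chart).choose)
    (hle : TpH.map (TemperedGraphGroupData.exists_completion_of_prop36 S.Gc h36
      S.chart).choose_spec.choose.toMonoidHom ≤ HatH)
    (cuspMeetsH : {x : X.Pt // X.IsCusp x} → Prop) {H : S.Gc.graph.Subgraph}
    (hTpHv : ∀ v ∈ H.verts, ∃ K ∈ verticialSubgroups S.chart v, K ≤ TpH) (x : {x : X.Pt // X.IsCusp x})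
    (hx : ∃ v ∈ H.verts, ∃ K ∈ verticialSubgroups S.chart v,
      ((X.inertia x.1).subgroupOf (X.toTemperedArithmeticGroup d).delta).map S.admissible.toMonoidHom ≤ K) :
    ∃ t : (ofSpecialFibre X d S h36 Sigma SigmaHat hsub hne hprime hp TpH HatH hle cuspMeetsH).graph.Tp,
      ((ofSpecialFibre X d S h36 Sigma SigmaHat hsub hne hprime hp TpH HatH hle cuspMeetsH).inertiaTp x).map
          (ofSpecialFibre X d S h36 Sigma SigmaHat hsub hne hprime hp TpH HatH hle cuspMeetsH).ρTp ≤
        MulAut.conj t • (ofSpecialFibre X d S h36 Sigma SigmaHat hsub hne hprime hp TpH HatH hle cuspMeetsH).graph.TpH := by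
  obtain ⟨t, ht⟩ := le_conj_smul_of_verticialOver S.chart hTpHv hx
  have key := map_ρTp_inertiaTp_ofSpecialFibre X d S h36 Sigma SigmaHat hsub hne hprime hp TpH HatH hle cuspMeetsH x
  exact ⟨t, (le_of_eq key).trans ht⟩

/-- **[IUTchI] Cor. 2.3 (vi) AS TYPED at the genuine 𝔛-datum, (vi)(b) atom in GROUP form, print's `Π̂_ℍ :=` closure of
`ι(Π^tp_ℍ)`, any `Π^tp_ℍ = TpH` containing a verticial subgroup of each vertex of `ℍ` — HOLDS IFF the PROFINITE incidence
`hhatV` holds for every cusp**: "`ι(J_x)` in a `Π̂_𝔾`-conjugate of `Π̂_ℍ` ⇒ `J_x` verticial over `ℍ`" (NO other law; no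
origin data in the residual).  FQ type per the gate rule.
[cite: Mochizuki2012, Cor 2.3(vi) pp.48-49] [claim: Mochizuki2012, status: disputed] -/
theorem cor23vi_ofSpecialFibre_verticialOver_iff_hatIncidence {H : S.Gc.graph.Subgraph}
    (hTpHv : ∀ v ∈ H.verts, ∃ K ∈ verticialSubgroups S.chart v, K ≤ TpH) :
    Literature.IUT.HodgeTheaters.StableCurveTemperedData.Cor23vi
        (ofSpecialFibre X d S h36 Sigma SigmaHat hsub hne hprime hp TpH ((TpH.map
          (TemperedGraphGroupData.exists_completion_of_prop36 S.Gc h36 S.chart).choose_spec.choose.toMonoidHom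
          ).topologicalClosure) (Subgroup.le_topologicalClosure _)
          (fun x => ∃ v ∈ H.verts, ∃ K ∈ verticialSubgroups S.chart v,
            ((X.inertia x.1).subgroupOf (X.toTemperedArithmeticGroup d).delta).map S.admissible.toMonoidHom ≤ K)) ↔
      ∀ x : {x : X.Pt // X.IsCusp x},
        (∃ g : (TemperedGraphGroupData.exists_completion_of_prop36 S.Gc h36 S.chart).choose,
          (((X.inertia x.1).subgroupOf (X.toTemperedArithmeticGroup d).delta).map S.admissible.toMonoidHom).map
              (TemperedGraphGroupData.exists_completion_of_prop36 S.Gc h36 S.chart).choose_spec.choose.toMonoidHom ≤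
            MulAut.conj g • (TpH.map (TemperedGraphGroupData.exists_completion_of_prop36 S.Gc h36
              S.chart).choose_spec.choose.toMonoidHom).topologicalClosure) →
        ∃ v ∈ H.verts, ∃ K ∈ verticialSubgroups S.chart v,
          ((X.inertia x.1).subgroupOf (X.toTemperedArithmeticGroup d).delta).map S.admissible.toMonoidHom ≤ K := by
  -- the bridge `ρ^tp(I_x) = J_x` at this datum (an equation, used through `congrArg`, never by `rw`)
  have key := fun x : {x : X.Pt // X.IsCusp x} =>
    map_ρTp_inertiaTp_ofSpecialFibre X d S h36 Sigma SigmaHat hsub hne hprime hp TpH ((TpH.map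
      (TemperedGraphGroupData.exists_completion_of_prop36 S.Gc h36 S.chart).choose_spec.choose.toMonoidHom
      ).topologicalClosure) (Subgroup.le_topologicalClosure _)
      (fun x => ∃ v ∈ H.verts, ∃ K ∈ verticialSubgroups S.chart v,
        ((X.inertia x.1).subgroupOf (X.toTemperedArithmeticGroup d).delta).map S.admissible.toMonoidHom ≤ K) x
  constructor
  · intro h x hx
    have hinc := ((cor23vi_iff_graph _).1 h).2 x
    refine hinc.1 ?_
    obtain ⟨g, hg⟩ := hx
    exact ⟨g, (congrArg (Subgroup.map (ofSpecialFibre X d S h36 Sigma SigmaHat hsub hne hprime hp TpH ((TpH.map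
          (TemperedGraphGroupData.exists_completion_of_prop36 S.Gc h36 S.chart).choose_spec.choose.toMonoidHom
          ).topologicalClosure) (Subgroup.le_topologicalClosure _)
          (fun x => ∃ v ∈ H.verts, ∃ K ∈ verticialSubgroups S.chart v,
            ((X.inertia x.1).subgroupOf (X.toTemperedArithmeticGroup d).delta).map S.admissible.toMonoidHom ≤ K)
          ).graph.ι) (key x)).trans_le hg⟩
  · intro hhatV
    refine cor23vi_of_graph _ (fun x hx => ?_) (fun x hx => ?_)
    · exact inertia_le_conj_of_verticialOver X d S h36 Sigma SigmaHat hsub hne hprime hp TpH _ _ _ hTpHv x hx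
    · obtain ⟨g, hg⟩ := hx
      exact hhatV x ⟨g, (congrArg (Subgroup.map (ofSpecialFibre X d S h36 Sigma SigmaHat hsub hne hprime hp TpH ((TpH.map
          (TemperedGraphGroupData.exists_completion_of_prop36 S.Gc h36 S.chart).choose_spec.choose.toMonoidHom
          ).topologicalClosure) (Subgroup.le_topologicalClosure _)
          (fun x => ∃ v ∈ H.verts, ∃ K ∈ verticialSubgroups S.chart v,
            ((X.inertia x.1).subgroupOf (X.toTemperedArithmeticGroup d).delta).map S.admissible.toMonoidHom ≤ K)
          ).graph.ι) (key x)).symm.trans_le hg⟩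

/-- **Row `IUTchI:Cor2.3(vi)` at the genuine datum, group-form atom, for EVERY `Π^tp_ℍ := TpH ∈ decompSubgroups S.chart ℍ`**,
general connected `ℍ` with a vertex, print's `Π̂_ℍ` — ONE binder, the profinite incidence `hhatV` (abc-iut-w4-d070's
`exists_verticial_le_of_mem_decompSubgroups` supplies `hTpHv`).  FQ type per the gate rule.
[cite: Mochizuki2012, Cor 2.3(vi) pp.48-49] [claim: Mochizuki2012, status: disputed] -/
theorem cor23vi_ofSpecialFibre_verticialOver_of_mem_decompSubgroups {H : S.Gc.graph.Subgraph}
    (hTpH : TpH ∈ S.chart.decompSubgroups H) (hconn : (S.Gc.restrict H).IsConnected)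
    (hv : (S.Gc.restrict H).HasVertex)
    (hhatV : ∀ x : {x : X.Pt // X.IsCusp x},
        (∃ g : (TemperedGraphGroupData.exists_completion_of_prop36 S.Gc h36 S.chart).choose,
          (((X.inertia x.1).subgroupOf (X.toTemperedArithmeticGroup d).delta).map S.admissible.toMonoidHom).map
              (TemperedGraphGroupData.exists_completion_of_prop36 S.Gc h36 S.chart).choose_spec.choose.toMonoidHom ≤
            MulAut.conj g • (TpH.map (TemperedGraphGroupData.exists_completion_of_prop36 S.Gc h36
              S.chart).choose_spec.choose.toMonoidHom).topologicalClosure) →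
        ∃ v ∈ H.verts, ∃ K ∈ verticialSubgroups S.chart v,
          ((X.inertia x.1).subgroupOf (X.toTemperedArithmeticGroup d).delta).map S.admissible.toMonoidHom ≤ K) :
    Literature.IUT.HodgeTheaters.StableCurveTemperedData.Cor23vi
        (ofSpecialFibre X d S h36 Sigma SigmaHat hsub hne hprime hp TpH ((TpH.map
          (TemperedGraphGroupData.exists_completion_of_prop36 S.Gc h36 S.chart).choose_spec.choose.toMonoidHom
          ).topologicalClosure) (Subgroup.le_topologicalClosure _)
          (fun x => ∃ v ∈ H.verts, ∃ K ∈ verticialSubgroups S.chart v,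
            ((X.inertia x.1).subgroupOf (X.toTemperedArithmeticGroup d).delta).map S.admissible.toMonoidHom ≤ K)) :=
  (cor23vi_ofSpecialFibre_verticialOver_iff_hatIncidence X d S h36 Sigma SigmaHat hsub hne hprime hp TpH
    (exists_verticial_le_of_mem_decompSubgroups X d S h36 TpH hTpH hconn hv)).2 hhatV

/-! ### 4. LAW-FREE instance: `ℍ` containing every vertex of `𝔾^c` (e.g. `ℍ = 𝔾^c`) -/

/-- At an `ℍ` containing ALL vertices the profinite incidence `hhatV` is a THEOREM (its conclusion is `exists_verticial_ge_cuspImage`).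
[cite: MochizukiSemiAnbd2006, Thm 3.7(iii) p.41] -/
theorem hatIncidence_verticialOver_of_verts_univ (hCV : CompactInVerticialAt S.Gc) {H : S.Gc.graph.Subgraph}
    (hall : ∀ v, v ∈ H.verts) (x : {x : X.Pt // X.IsCusp x}) :
    (∃ g : (TemperedGraphGroupData.exists_completion_of_prop36 S.Gc h36 S.chart).choose,
          (((X.inertia x.1).subgroupOf (X.toTemperedArithmeticGroup d).delta).map S.admissible.toMonoidHom).map
              (TemperedGraphGroupData.exists_completion_of_prop36 S.Gc h36 S.chart).choose_spec.choose.toMonoidHom ≤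
            MulAut.conj g • (TpH.map (TemperedGraphGroupData.exists_completion_of_prop36 S.Gc h36
              S.chart).choose_spec.choose.toMonoidHom).topologicalClosure) →
        ∃ v ∈ H.verts, ∃ K ∈ verticialSubgroups S.chart v,
          ((X.inertia x.1).subgroupOf (X.toTemperedArithmeticGroup d).delta).map S.admissible.toMonoidHom ≤ K := by
  intro _
  obtain ⟨v, K, hK, hJK⟩ := exists_verticial_ge_cuspImage X d S hCV x
  exact ⟨v, hall v, K, hK, hJK⟩

/-- **Row `IUTchI:Cor2.3(vi)` PROVED OUTRIGHT (ZERO laws) at the genuine datum for every `ℍ ⊇ V(𝔾^c)`** at the FINITE special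
fibre, group-form atom, any `Π^tp_ℍ = TpH` with a verticial subgroup at each vertex of `ℍ`.  FQ type per the gate rule.
[cite: Mochizuki2012, Cor 2.3(vi) pp.48-49] [claim: Mochizuki2012, status: disputed] -/
theorem cor23vi_ofSpecialFibre_verticialOver_of_verts_univ (hV : Finite S.Gc.graph.Vertex) (hE : Finite S.Gc.graph.Edge)
    {H : S.Gc.graph.Subgraph} (hall : ∀ v, v ∈ H.verts)
    (hTpHv : ∀ v ∈ H.verts, ∃ K ∈ verticialSubgroups S.chart v, K ≤ TpH) :
    Literature.IUT.HodgeTheaters.StableCurveTemperedData.Cor23vi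
        (ofSpecialFibre X d S h36 Sigma SigmaHat hsub hne hprime hp TpH ((TpH.map
          (TemperedGraphGroupData.exists_completion_of_prop36 S.Gc h36 S.chart).choose_spec.choose.toMonoidHom
          ).topologicalClosure) (Subgroup.le_topologicalClosure _)
          (fun x => ∃ v ∈ H.verts, ∃ K ∈ verticialSubgroups S.chart v,
            ((X.inertia x.1).subgroupOf (X.toTemperedArithmeticGroup d).delta).map S.admissible.toMonoidHom ≤ K)) :=
  (cor23vi_ofSpecialFibre_verticialOver_iff_hatIncidence X d S h36 Sigma SigmaHat hsub hne hprime hp TpH hTpHv).2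
    (hatIncidence_verticialOver_of_verts_univ X d S h36 TpH (compactInVerticialAt_of_finiteGraph' hV hE) hall)

/-! ### 5. Comparison with the vertex predicate `vtx x ∈ ℍ` of abc-iut-w4-d070's closers (binders `hcusp`, `hhatH`) -/

variable (vtx : {x : X.Pt // X.IsCusp x} → S.Gc.graph.Vertex)

/-- `{hcusp, hhatH} ⇒ hhatV`: the group-form residual is implied by abc-iut-w4-d070's pair of laws (so it is the WEAKER binder).
[cite: Mochizuki2012, Cor 2.3(vi) pp.48-49] [claim: Mochizuki2012, status: disputed] -/
theorem hatIncidence_verticialOver_of_cuspLaws {H : S.Gc.graph.Subgraph}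
    (hcusp : ∀ x : {x : X.Pt // X.IsCusp x}, ∃ K ∈ verticialSubgroups S.chart (vtx x),
      ((X.inertia x.1).subgroupOf (X.toTemperedArithmeticGroup d).delta).map S.admissible.toMonoidHom ≤ K)
    {Q : {x : X.Pt // X.IsCusp x} → Prop} (hhatH : ∀ x, Q x → vtx x ∈ H.verts) (x : {x : X.Pt // X.IsCusp x})
    (hQ : Q x) :
    ∃ v ∈ H.verts, ∃ K ∈ verticialSubgroups S.chart v,
      ((X.inertia x.1).subgroupOf (X.toTemperedArithmeticGroup d).delta).map S.admissible.toMonoidHom ≤ K :=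
  ⟨vtx x, hhatH x hQ, hcusp x⟩

/-- **Under the cusp ↦ OPEN-edge dictionary the two atoms AGREE**: if `J_x ≠ 1` is an edge-like subgroup of an open edge and
is verticial at `vtx x` (`hcusp`), then "`J_x` verticial over `ℍ`" ⟺ "`vtx x ∈ ℍ`" — at the FINITE special fibre (Thm. 3.7
(ii)(iii), `EdgeLikeDistinct`). [cite: MochizukiSemiAnbd2006, Thm 3.7(iii) p.41] -/
theorem verticialOver_iff_vtx_mem_of_openEdgeLike (hV : Finite S.Gc.graph.Vertex) (hE : Finite S.Gc.graph.Edge)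
    {H : S.Gc.graph.Subgraph} (x : {x : X.Pt // X.IsCusp x})
    (hcuspx : ∃ K ∈ verticialSubgroups S.chart (vtx x),
      ((X.inertia x.1).subgroupOf (X.toTemperedArithmeticGroup d).delta).map S.admissible.toMonoidHom ≤ K)
    (hedge : ∃ e : S.Gc.graph.Edge, ¬ S.Gc.graph.IsClosedEdge e ∧
      ((X.inertia x.1).subgroupOf (X.toTemperedArithmeticGroup d).delta).map S.admissible.toMonoidHom ∈
        edgeLikeSubgroups S.chart e)
    (hJ1 : ((X.inertia x.1).subgroupOf (X.toTemperedArithmeticGroup d).delta).map S.admissible.toMonoidHom ≠ ⊥) :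
    (∃ v ∈ H.verts, ∃ K ∈ verticialSubgroups S.chart v,
      ((X.inertia x.1).subgroupOf (X.toTemperedArithmeticGroup d).delta).map S.admissible.toMonoidHom ≤ K) ↔
      vtx x ∈ H.verts := by
  refine ⟨fun ⟨v, hv, K, hK, hJK⟩ => ?_, fun hx => ⟨vtx x, hx, hcuspx⟩⟩
  obtain ⟨K₀, hK₀, hJK₀⟩ := hcuspx
  obtain ⟨e, he, hJe⟩ := hedge
  rwa [← eq_of_verticial_ge_of_openEdgeLike S.hyp (compactInVerticialAt_of_finiteGraph' hV hE)
    (@edgeLikeDistinctAt_of_finiteGraph _ hV hE) S.chart (isCompact_cuspImage X d S x) hJ1 he hJe hK hK₀ hJK hJK₀]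

/-- **`hhatV ∧ hcusp ⇒ hhatH` under the open-edge dictionary**: with the record-style vertex `vtx` the UNIQUE carrier of
`J_x`, abc-iut-w4-d070's profinite law for `vtx` follows from the group-form law — so, granted the dictionary named in GAP
G-w4d070-g11-1, the two residuals are EQUIVALENT and the node's open content is `hhatV` alone.
[cite: Mochizuki2012, Cor 2.3(vi) pp.48-49] [claim: Mochizuki2012, status: disputed] -/
theorem hatIncidence_vtx_of_verticialOver_of_openEdgeLike (hV : Finite S.Gc.graph.Vertex)
    (hE : Finite S.Gc.graph.Edge) {H : S.Gc.graph.Subgraph}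
    (hcusp : ∀ x : {x : X.Pt // X.IsCusp x}, ∃ K ∈ verticialSubgroups S.chart (vtx x),
      ((X.inertia x.1).subgroupOf (X.toTemperedArithmeticGroup d).delta).map S.admissible.toMonoidHom ≤ K)
    (hedge : ∀ x : {x : X.Pt // X.IsCusp x}, ∃ e : S.Gc.graph.Edge, ¬ S.Gc.graph.IsClosedEdge e ∧
      ((X.inertia x.1).subgroupOf (X.toTemperedArithmeticGroup d).delta).map S.admissible.toMonoidHom ∈
        edgeLikeSubgroups S.chart e)
    (hJ1 : ∀ x : {x : X.Pt // X.IsCusp x},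
      ((X.inertia x.1).subgroupOf (X.toTemperedArithmeticGroup d).delta).map S.admissible.toMonoidHom ≠ ⊥)
    {Q : {x : X.Pt // X.IsCusp x} → Prop}
    (hhatV : ∀ x, Q x → ∃ v ∈ H.verts, ∃ K ∈ verticialSubgroups S.chart v,
      ((X.inertia x.1).subgroupOf (X.toTemperedArithmeticGroup d).delta).map S.admissible.toMonoidHom ≤ K)
    (x : {x : X.Pt // X.IsCusp x}) (hQ : Q x) : vtx x ∈ H.verts :=
  (verticialOver_iff_vtx_mem_of_openEdgeLike X d S vtx hV hE x (hcusp x) (hedge x) (hJ1 x)).1 (hhatV x hQ)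

end Rows

/-! ### 6. Over abc-iut-L3's origin record `SpecialFibreTower.PiData` (`ℍ := P.H`, `Π^tp_ℍ := P.TpH`, finiteness `P.finite`) -/

section PiData

variable {p : ℕ} [Fact p.Prime] (X : TemperedCurve p) (d : X.GroupLevelData)
  (S : SpecialFibreData (X.toTemperedArithmeticGroup d)) (h36 : S.Gc.Prop36Hypotheses)
  (Sigma SigmaHat : Set ℕ) (hsub : Sigma ⊆ SigmaHat) (hne : Sigma.Nonempty)
  (hprime : ∀ q ∈ SigmaHat, q.Prime) (hp : p ∉ Sigma)
  {T : SpecialFibreTower X.DeltaTemp} (P : SpecialFibreTower.PiData X d S T)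

include P in
/-- **At the origin record, the base cusp incidence at SOME vertex is a THEOREM** (finite fibre `P.finite`); what the record does
NOT determine is that this vertex is `(P.proj i)(P.vtxOfCusp i x)` (GAP G-w4d070-g11-1, origin data).
[cite: MochizukiSemiAnbd2006, Thm 3.7(iii) p.41] -/
theorem exists_verticial_ge_cuspImage_piData (x : {x : X.Pt // X.IsCusp x}) :
    ∃ (v : S.Gc.graph.Vertex), ∃ K ∈ verticialSubgroups S.chart v,
      ((X.inertia x.1).subgroupOf (X.toTemperedArithmeticGroup d).delta).map S.admissible.toMonoidHom ≤ K :=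
  exists_verticial_ge_cuspImage X d S
    (compactInVerticialAt_of_finiteGraph' P.finite.finite_vertex_base P.finite.finite_edge_base) x

/-- **Row `IUTchI:Cor2.3(vi)` over the origin record with `Π^tp_ℍ := P.TpH`, group-form atom — ONE binder `hhatV`.**
FQ type per the gate rule. [cite: Mochizuki2012, Cor 2.3(vi) pp.48-49] [claim: Mochizuki2012, status: disputed] -/
theorem cor23vi_ofSpecialFibre_verticialOver_piDataTpH
    (hhatV : ∀ x : {x : X.Pt // X.IsCusp x},
        (∃ g : (TemperedGraphGroupData.exists_completion_of_prop36 S.Gc h36 S.chart).choose,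
          (((X.inertia x.1).subgroupOf (X.toTemperedArithmeticGroup d).delta).map S.admissible.toMonoidHom).map
              (TemperedGraphGroupData.exists_completion_of_prop36 S.Gc h36 S.chart).choose_spec.choose.toMonoidHom ≤
            MulAut.conj g • (P.TpH.map (TemperedGraphGroupData.exists_completion_of_prop36 S.Gc h36
              S.chart).choose_spec.choose.toMonoidHom).topologicalClosure) →
        ∃ v ∈ P.H.verts, ∃ K ∈ verticialSubgroups S.chart v,
          ((X.inertia x.1).subgroupOf (X.toTemperedArithmeticGroup d).delta).map S.admissible.toMonoidHom ≤ K) :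
    Literature.IUT.HodgeTheaters.StableCurveTemperedData.Cor23vi
        (ofSpecialFibre X d S h36 Sigma SigmaHat hsub hne hprime hp P.TpH ((P.TpH.map
          (TemperedGraphGroupData.exists_completion_of_prop36 S.Gc h36 S.chart).choose_spec.choose.toMonoidHom
          ).topologicalClosure) (Subgroup.le_topologicalClosure _)
          (fun x => ∃ v ∈ P.H.verts, ∃ K ∈ verticialSubgroups S.chart v,
            ((X.inertia x.1).subgroupOf (X.toTemperedArithmeticGroup d).delta).map S.admissible.toMonoidHom ≤ K)) :=
  (cor23vi_ofSpecialFibre_verticialOver_iff_hatIncidence X d S h36 Sigma SigmaHat hsub hne hprime hp P.TpH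
    P.TpH_verticial).2 hhatV

end PiData

end StableCurveTemperedData
end Literature.IUT.HodgeTheaters
end
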